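import Summits.Ventures.PercRepro.S1TriangleLeverExact
import Summits.Ventures.PercRepro.S1RowNineFrame

/-!
# PercRepro — THE CELL `(9, 10)`, AND ROW 9 RE-PRICED BY THE TRIANGLE LEVER (p2, gen 26; SUBCLAIM-S1 §6.10)

`triT 10 19 = 16` (S1TriangleLeverExact): a coloop-free `e`-free core of rank `9` on `19` points has at most `16`
triangles, so the cap (P9,10) of S1CellNineReducedP — needed at `t ≥ 18` only — is vacuous and **THE CELL `(9, 10)`
CLOSES**. Likewise `triT 9 18 = 14` and `triT 8 17 = triT 8 16 = 12` cut the caps of `(9, 9)` to `9 ≤ t ≤ 14` and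
of `(9, 8)` to `1 ≤ t ≤ 12` (17 points) / `10 ≤ t ≤ 12` (16 points); END 9 is restated modulo the six remaining
hypotheses.

* **`c025_core_nine_ten`** — `RLS` at `(9, 4)` on every `e`-free core of rank `9` with `19` points (THE CELL);
* **`c025_core_nine_nine_of_cap''`**, **`c025_core_nine_eight_of_caps'''`** — the caps bounded above in `t`;
* **`c025_four_nine_of_caps'`** — END 9 modulo the cells `(9, 5)`, `(9, 6)`, `(9, 7)` and the three bounded tables.
Axioms: standard.
-/

open scoped Matroid

namespace PercRepro

namespace S1

open Set

variable {α : Type}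

/-- **THE CELL `(9, 10)`**: `RLS` at `(9, 4)` on every `e`-free core of rank `9` with `19` points — the cap of
S1CellNineReducedP is needed at `t ≥ 18` only, and `s₃ ≤ triT 10 19 = 16`. -/
theorem c025_core_nine_ten (M : Matroid α) [M.Finite] (hR : M.eRank = (9 : ℕ)) (hn : M.E.ncard = 19)
    (hfree : ∀ e ∈ M.E, ∃ A ⊆ M.E \ {e}, e ∉ M.closure A ∧ e ∉ M.closure ((M.E \ {e}) \ A)) :
    ThmN.RLS M 9 4 := by
  refine c025_core_nine_ten_of_cap'' M hR hn hfree ?_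
  intro N _ hNfree hNd hNn hNcol t ht18 hs
  exfalso
  have h := ncard_triangles_le_triT 10 N hNfree hNd hNcol
  rw [hNn, triT_values.1, hs] at h
  omega

/-- **THE CELL `(9, 9)` MODULO THE CAP AT `9 ≤ t ≤ 14`**: `s₃ ≤ triT 9 18 = 14`. -/
theorem c025_core_nine_nine_of_cap'' (M : Matroid α) [M.Finite] (hR : M.eRank = (9 : ℕ)) (hn : M.E.ncard = 18)
    (hfree : ∀ e ∈ M.E, ∃ A ⊆ M.E \ {e}, e ∉ M.closure A ∧ e ∉ M.closure ((M.E \ {e}) \ A))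
    (hcap : ∀ (N : Matroid α) [N.Finite],
      (∀ e ∈ N.E, ∃ A ⊆ N.E \ {e}, e ∉ N.closure A ∧ e ∉ N.closure ((N.E \ {e}) \ A)) →
      N.E.encard = N.eRank + ((9 : ℕ) : ℕ∞) → N.E.ncard = 18 → N.coloops = ∅ →
      ∀ t, 9 ≤ t → t ≤ 14 → {C : Set α | N.IsCircuit C ∧ C.ncard = 3}.ncard = t →
      {C : Set α | N.IsCircuit C ∧ C.ncard = 4}.ncard ≤ capNineNineT t) :
    ThmN.RLS M 9 4 := by
  refine c025_core_nine_nine_of_cap' M hR hn hfree ?_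
  intro N _ hNfree hNd hNn hNcol t ht9 hs
  have h := ncard_triangles_le_triT 9 N hNfree hNd hNcol
  rw [hNn, triT_values.2.1, hs] at h
  exact hcap N hNfree hNd hNn hNcol t ht9 h hs

/-- **THE CELL `(9, 8)` MODULO THE BOUNDED TABLES**: on `17` points at `1 ≤ t ≤ 12`, on `16` points at
`10 ≤ t ≤ 12` (`triT 8 17 = triT 8 16 = 12`). -/
theorem c025_core_nine_eight_of_caps''' (M : Matroid α) [M.Finite] (hR : M.eRank = (9 : ℕ)) (hn : M.E.ncard = 17)
    (hfree : ∀ e ∈ M.E, ∃ A ⊆ M.E \ {e}, e ∉ M.closure A ∧ e ∉ M.closure ((M.E \ {e}) \ A))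
    (hcap17 : ∀ (N : Matroid α) [N.Finite],
      (∀ e ∈ N.E, ∃ A ⊆ N.E \ {e}, e ∉ N.closure A ∧ e ∉ N.closure ((N.E \ {e}) \ A)) →
      N.E.encard = N.eRank + ((8 : ℕ) : ℕ∞) → N.E.ncard = 17 → N.coloops = ∅ →
      ∀ t, 1 ≤ t → t ≤ 12 → {C : Set α | N.IsCircuit C ∧ C.ncard = 3}.ncard = t →
      {C : Set α | N.IsCircuit C ∧ C.ncard = 4}.ncard ≤ capNineEight17 t)
    (hcap16 : ∀ (N : Matroid α) [N.Finite],
      (∀ e ∈ N.E, ∃ A ⊆ N.E \ {e}, e ∉ N.closure A ∧ e ∉ N.closure ((N.E \ {e}) \ A)) →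
      N.E.encard = N.eRank + ((8 : ℕ) : ℕ∞) → N.E.ncard = 16 → N.coloops = ∅ →
      ∀ t, 10 ≤ t → t ≤ 12 → {C : Set α | N.IsCircuit C ∧ C.ncard = 3}.ncard = t →
      {C : Set α | N.IsCircuit C ∧ C.ncard = 4}.ncard ≤ capNineEight16 t) :
    ThmN.RLS M 9 4 := by
  refine c025_core_nine_eight_of_caps'' M hR hn hfree ?_ ?_
  · intro N _ hNfree hNd hNn hNcol t ht1 hs
    have h := ncard_triangles_le_triT 8 N hNfree hNd hNcol
    rw [hNn, triT_values.2.2.1, hs] at h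
    exact hcap17 N hNfree hNd hNn hNcol t ht1 h hs
  · intro N _ hNfree hNd hNn hNcol t ht10 hs
    have h := ncard_triangles_le_triT 8 N hNfree hNd hNcol
    rw [hNn, triT_values.2.2.2, hs] at h
    exact hcap16 N hNfree hNd hNn hNcol t ht10 h hs

/-- **C-025 AT LEVEL `4` FOR EVERY `p ≥ 9`, MODULO THE SIX REMAINING HYPOTHESES OF ROW 9**: the cells `(9, 5)`,
`(9, 6)`, `(9, 7)` and the three bounded cap tables of `(9, 8)` and `(9, 9)`. -/
theorem c025_four_nine_of_caps' (h5 : CellNine (α := α) 5) (h6 : CellNine (α := α) 6) (h7 : CellNine (α := α) 7)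
    (hcap17 : ∀ (N : Matroid α) [N.Finite],
      (∀ e ∈ N.E, ∃ A ⊆ N.E \ {e}, e ∉ N.closure A ∧ e ∉ N.closure ((N.E \ {e}) \ A)) →
      N.E.encard = N.eRank + ((8 : ℕ) : ℕ∞) → N.E.ncard = 17 → N.coloops = ∅ →
      ∀ t, 1 ≤ t → t ≤ 12 → {C : Set α | N.IsCircuit C ∧ C.ncard = 3}.ncard = t →
      {C : Set α | N.IsCircuit C ∧ C.ncard = 4}.ncard ≤ capNineEight17 t)
    (hcap16 : ∀ (N : Matroid α) [N.Finite],
      (∀ e ∈ N.E, ∃ A ⊆ N.E \ {e}, e ∉ N.closure A ∧ e ∉ N.closure ((N.E \ {e}) \ A)) →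
      N.E.encard = N.eRank + ((8 : ℕ) : ℕ∞) → N.E.ncard = 16 → N.coloops = ∅ →
      ∀ t, 10 ≤ t → t ≤ 12 → {C : Set α | N.IsCircuit C ∧ C.ncard = 3}.ncard = t →
      {C : Set α | N.IsCircuit C ∧ C.ncard = 4}.ncard ≤ capNineEight16 t)
    (hcap9 : ∀ (N : Matroid α) [N.Finite],
      (∀ e ∈ N.E, ∃ A ⊆ N.E \ {e}, e ∉ N.closure A ∧ e ∉ N.closure ((N.E \ {e}) \ A)) →
      N.E.encard = N.eRank + ((9 : ℕ) : ℕ∞) → N.E.ncard = 18 → N.coloops = ∅ →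
      ∀ t, 9 ≤ t → t ≤ 14 → {C : Set α | N.IsCircuit C ∧ C.ncard = 3}.ncard = t →
      {C : Set α | N.IsCircuit C ∧ C.ncard = 4}.ncard ≤ capNineNineT t)
    (M : Matroid α) [M.Finite] (p : ℕ) (hp : 9 ≤ p) : ThmN.RLS M p 4 :=
  c025_four_nine_of_cells h5 h6 h7
    (fun M _ hR hn hfree => c025_core_nine_eight_of_caps''' M hR hn hfree hcap17 hcap16)
    (fun M _ hR hn hfree => c025_core_nine_nine_of_cap'' M hR hn hfree hcap9)
    (fun M _ hR hn hfree => c025_core_nine_ten M hR hn hfree) M p hp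

end S1

end PercRepro
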